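import Summits.BirchSwinnertonDyer.BirchSwinnertonDyer.Theorems.PrintCf2RamifiedOffTYZRedeiCellsR2
import HarnessLib

/-!
# WORKFILE (crux stmt-BirchSwinnertonDyer-20509 `RamifiedOffTYZOfFacts`, line `offtyz-v7`, LEAD cruxlead-20509 g27, cycle 28) —
# THE THREE EXPLICIT RÉDEI / 8-RANK LAWS OF R2 AS TYPED CONJECTURES, and the kernel composition «laws ⟹ C⁺ on R2»

Status: CONJECTURES typed for the planner / the disprover / the next lead; `def … : Prop` only because this is a crux WORKFILE
(`Cruxes/RamifiedOffTYZOfFacts/Lines/`), never a Theorems/Literature proposal.  Nothing here is asserted.  Companion memo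
`Lines/offtyz_v7_RedeiLaws.md`; kernel `Theorems/PrintCf2RamifiedOffTYZRedeiCellsR2.lean` (p793034, rev 2 p793191); evidence
`REDEI-LAWS-R2-g27.md` on item 20509 (122/122 census rows + 64 fresh rows, 0 exceptions).

R2 = {n = lq : l ≡ 1, q ≡ 7 (mod 8) primes, (l/q) = 1}.  Symbols of a pair (l, q):
* `RedeiTwo l q`      — `[2, l, q] = +1`: for `l = a² − 2b²`, `a > 0`, `r² = 2` in `ℤ/q`, `a + b r` is a square in `ℤ/q`
                        (numerically ⟺ the class of a prime above 2 in `Cl(ℚ(√−lq))` is a fourth power; `[2,l,q][2,q,l] = +1 ⟺ l = x²+32y²`);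
* `FourthPower l q`   — `(q/l)₄ = +1`: `q` is a fourth power in `ℤ/l` (⟺ `8 ∣ h(ℚ(√−lq))`);
* `Delta l`           — the tree's digit `δ(l)`: `ord L(E_l) = 0 ∧ #Sel₄(E_l) = 2⁴` (⟺ `l ≠ x² + 32y²`, [Wang2016CongruentSha, Thm 3] + rank-0 BSD₂).
Laws (each a closed-form statement; LAW Z is the CM-side / U-road statement, LAW V and LAW S are second-descent statements):
* `GenusPeriodRedeiLawR2`  (LAW Z): depth_{A(ℍ′)} Z(lq) ≥ 1 ⟺ ¬δ(l) ∧ [2,l,q] = +1; and = 1 exactly when moreover (q/l)₄ = −1.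
* `VisibilityRedeiLawR2`   (LAW V): a generator h = (X, Y) of A_{lq}(ℚ)/tors has X ∈ 2ℚ^{×2} ⟺ ¬δ(l) ∧ [2,l,q] = +1 ∧ (q/l)₄ = −1.
* `JumpOneRedeiLawR2`      (LAW S): #Sel₂(E_{lq}) = 2⁵ ∧ #Sel₄(E_{lq}) = 2⁶ ⟹ ¬(¬δ(l) ∧ [2,l,q] = +1 ∧ (q/l)₄ = +1).
Composition (kernel, `RedeiCellsR2.levelTwoScriptLExact_R2_of_laws_of_bundle'`): 𝔅_ram ∧ `tyz_genusPointBlockData` ∧ LAW Z ∧ LAW V ∧ LAW S ⟹ item 23431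
at every n = lq on R2 (`levelTwoScriptLExact_R2_of_redeiLaws` below).  BSD is not proved by any of this; 20509 / 23431 / 23432 OPEN.
-/

noncomputable section

open scoped Classical

open WeierstrassCurve WeierstrassCurve.Affine WeierstrassCurve.Affine.Point
  Literature.NumberTheory.EllipticCurves Literature.NumberTheory.EllipticCurves.Rank1Residual
  Summit.BirchSwinnertonDyer.Rank1Residual
  Literature.NumberTheory.EllipticCurves.TianYuanZhang2017
  Literature.NumberTheory.EllipticCurves.TianYuanZhang2017.W2
  Summit.BirchSwinnertonDyer.PrintCf2.GenusPeriodR2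
  Summit.BirchSwinnertonDyer.PrintCf2.RedeiCellsR2

set_option autoImplicit false

namespace Summit.BirchSwinnertonDyer.PrintCf2.LevelTwo.RedeiLaws

/-! ## §1 The symbols -/

/-- The Rédei-type symbol `[2, l, q] = +1` of a pair of primes `l ≡ 1`, `q ≡ 7 (mod 8)`: every presentation `l = a² − 2b²` with `a > 0` and every
square root `r` of `2` in `ℤ/q` give `a + b r` a square in `ℤ/q` (all choices agree: conjugate presentations differ by the class of `l`, a square mod `q`
on R2, and units by `(1+√2)^{2k}`).  Instrument dictionary: ⟺ `[𝔭₂] ∈ Cl(ℚ(√−lq))⁴`. -/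
def RedeiTwo (l q : ℕ) : Prop :=
  ∀ a b r : ℤ, (l : ℤ) = a ^ 2 - 2 * b ^ 2 → 0 < a → (r : ZMod q) ^ 2 = 2 → IsSquare ((a + b * r : ℤ) : ZMod q)

/-- `(q/l)₄ = +1`: `q` is a fourth power modulo `l` (instrument dictionary: ⟺ `8 ∣ h(ℚ(√−lq))` on R2). -/
def FourthPower (l q : ℕ) : Prop :=
  ∃ x : ZMod l, x ^ 4 = (q : ZMod l)

/-- The tree's rank-zero digit `δ(l)` of the prime block `l ≡ 1 (mod 8)`: `ord_{s=1} L(E_l, s) = 0 ∧ #Sel₄(E_l) = 2⁴` (⟺ `𝓛(l) ≡ 2 (mod 4)`;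
by [Wang2016CongruentSha, Thm 3] ⟺ `l ≠ x² + 32y²`). -/
def Delta (l : ℕ) : Prop :=
  (congruentNumberCurve l).analyticRank = 0 ∧ Nat.card ((congruentNumberCurve l).selmerGroup 4) = 2 ^ 4

/-! ## §2 The laws (CONJECTURES; LAW Z beyond print, LAW V / LAW S second-descent statements not in print for this family) -/

/-- **CONJECTURE LAW Z (genus-period Rédei law on R2).**  For primes `l ≡ 1`, `q ≡ 7 (mod 8)` with `(l/q) = 1` and `ord_{s=1} L(E_{lq}, s) = 1`, on every
display package `D` of `lq` ([TianYuanZhang2017] §3 with the CM-point layer and Thm 3.5 at blocks):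
`Z(lq) ∈ 2A(ℍ′_{lq}) + tors ⟺ ¬δ(l) ∧ [2,l,q] = +1`, and if moreover `(q/l)₄ = −1` then `Z(lq) ∉ 4A(ℍ′_{lq}) + tors`.
(Evidence: 122/122 rows n ≤ 2·10⁴ and 64/64 fresh rows n < 4·10⁴, exact arithmetic.) -/
def GenusPeriodRedeiLawR2 : Prop :=
  ∀ (l q : ℕ), l.Prime → q.Prime → l % 8 = 1 → q % 8 = 7 → IsSquare ((l : ℤ) : ZMod q) →
    (congruentNumberCurve (l * q)).analyticRank = 1 →
    ∀ D : GenusPointData (l * q), D.Printed → D.CMPointCompositumPrinted → D.Thm35AtBlocks →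
      ((∃ y : APoint D.H, IsOfFinAddOrder (D.Z (l * q) - (2 : ℤ) • y)) ↔ (¬ Delta l ∧ RedeiTwo l q)) ∧
      (¬ Delta l → RedeiTwo l q → ¬ FourthPower l q → ¬ ∃ y : APoint D.H, IsOfFinAddOrder (D.Z (l * q) - (4 : ℤ) • y))

/-- **CONJECTURE LAW V (visibility Rédei law on R2).**  For primes `l ≡ 1`, `q ≡ 7 (mod 8)` with `(l/q) = 1`, `ord_{s=1} L(E_{lq}, s) = 1`, and any
generator `h = (X, Y)` of `A_{lq}(ℚ)` modulo torsion: `X ∈ 2ℚ^{×2}` (the INVISIBLE class `d(h) = 2`) ⟺ `¬δ(l) ∧ [2,l,q] = +1 ∧ (q/l)₄ = −1`.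
(Evidence: 44/44 + 12/12; a Cassels–Tate statement on `Sel^{(φ)}(A_{lq})`, the rank-one analogue of [Wang2016CongruentSha, Thm 1].) -/
def VisibilityRedeiLawR2 : Prop :=
  ∀ (l q : ℕ), l.Prime → q.Prime → l % 8 = 1 → q % 8 = 7 → IsSquare ((l : ℤ) : ZMod q) →
    (congruentNumberCurve (l * q)).analyticRank = 1 →
    ∀ {X Y : ℚ} (h : (Atwo (l * q)).toAffine.Nonsingular X Y),
      (∀ P : (Atwo (l * q)).toAffine.Point, ∃ m : ℤ, IsOfFinAddOrder (P - m • (Point.some X Y h : (Atwo (l * q)).toAffine.Point))) →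
      ((∃ s : ℚ, X = 2 * s ^ 2) ↔ (¬ Delta l ∧ RedeiTwo l q ∧ ¬ FourthPower l q))

/-- **CONJECTURE LAW S (jump-one Rédei law on R2).**  For primes `l ≡ 1`, `q ≡ 7 (mod 8)` with `(l/q) = 1` and `ord_{s=1} L(E_{lq}, s) = 1`: the jump-one
Selmer shape `#Sel₂(E_{lq}) = 2⁵ ∧ #Sel₄(E_{lq}) = 2⁶` EXCLUDES the cell `¬δ(l) ∧ [2,l,q] = +1 ∧ (q/l)₄ = +1` (where `v₂(𝓛(lq)) = 2`, 9/9 rows — so, by BSD,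
`#Ш(E_{lq})[2^∞] = 16` there).  A second-descent statement (Cassels–Tate pairing on `Sel₂(E_{lq})`), cf. [Wang2016CongruentSha, Thm 1, Thm 3]. -/
def JumpOneRedeiLawR2 : Prop :=
  ∀ (l q : ℕ), l.Prime → q.Prime → l % 8 = 1 → q % 8 = 7 → IsSquare ((l : ℤ) : ZMod q) →
    (congruentNumberCurve (l * q)).analyticRank = 1 →
    Nat.card ((congruentNumberCurve (l * q)).selmerGroup 2) = 2 ^ 5 → Nat.card ((congruentNumberCurve (l * q)).selmerGroup 4) = 2 ^ 6 →
      ¬ (¬ Delta l ∧ RedeiTwo l q ∧ FourthPower l q)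

/-! ## §3 Kernel composition: the three laws ARE item 23431 on R2 (granted 𝔅_ram and the display) -/

/-- **LAW Z ∧ LAW V ∧ LAW S ⟹ item 23431 at every `n = lq` on R2**, granted 𝔅_ram VERBATIM and the display `tyz_genusPointBlockData` — the same cases proof as the kernel
theorem `RedeiCellsR2.levelTwoScriptLExact_R2_of_laws_of_bundle'` (`S := RedeiTwo`, `T := FourthPower`), written out over the cycle-27 iffs. -/
theorem levelTwoScriptLExact_R2_of_redeiLaws
    (hB : (Literature.NumberTheory.EllipticCurves.rank_eq_analyticRank_of_analyticRank_le_one ∧ WeierstrassCurve.hasEntireLFunction_rat ∧ WeierstrassCurve.bsdRHS_eq_of_isIsogenous ∧ Literature.NumberTheory.EllipticCurves.bsdTriple_of_hasCM_of_L_one_ne_zero ∧ Literature.NumberTheory.EllipticCurves.TianYuanZhang2017.thm12_parity_of_scriptL' ∧ Literature.NumberTheory.EllipticCurves.Tian2014.thm13_rank_one_and_sha_odd ∧ Literature.NumberTheory.QuadraticFields.RedeiReichardt.redeiReichardt_fourTwoCard_classGroup ∧ Literature.NumberTheory.EllipticCurves.LiLiuTian2024.thm12_bsd_congruentNumberCurve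 ∧ Literature.NumberTheory.EllipticCurves.Monsky1990.cor515_rank_eq_one_and_card_selmerGroup_two ∧ Literature.NumberTheory.EllipticCurves.HeathBrown1994.monsky_card_selmerGroup_two_even ∧ Literature.NumberTheory.EllipticCurves.Tian2014.tian2014_system_sMinus_genus))
    (hT : tyz_genusPointBlockData)
    (hZ : GenusPeriodRedeiLawR2) (hV : VisibilityRedeiLawR2) (hS : JumpOneRedeiLawR2)
    {l q : ℕ} (hl : l.Prime) (hq : q.Prime) (hl8 : l % 8 = 1) (hq8 : q % 8 = 7) (hlq : IsSquare ((l : ℤ) : ZMod q))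
    (hr : (congruentNumberCurve (l * q)).analyticRank = 1)
    (h₂ : Nat.card ((congruentNumberCurve (l * q)).selmerGroup 2) = 2 ^ 5)
    (h₄ : Nat.card ((congruentNumberCurve (l * q)).selmerGroup 4) = 2 ^ 6) :
    ∀ L : ℤ, IsScriptL (l * q) L → (2 : ℤ) ∣ L ∧ ¬ (4 : ℤ) ∣ L := by
  -- self-contained composition over the cycle-27 iffs (same proof as `RedeiCellsR2.levelTwo_R2_of_cellLaws'`)
  obtain ⟨hsq, h7, -⟩ := RankZeroDigitDepthTwo.sector_R2 hl hq hl8 hq8 (rfl : l * q = l * q)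
  obtain ⟨D, hPr, hC, hBl⟩ := hT (l * q) hsq (Or.inr (Or.inr h7))
  obtain ⟨X, Y, h, hgen⟩ := exists_atwo_generator hB.1 hsq hr
  obtain ⟨hZ', hZ4⟩ := hZ l q hl hq hl8 hq8 hlq hr D hPr hC hBl
  have hV' := hV l q hl hq hl8 hq8 hlq hr h hgen
  have hcell := hS l q hl hq hl8 hq8 hlq hr h₂ h₄
  by_cases hδ : Delta l
  · obtain ⟨α, hα, -⟩ := TwoPrimesByName.exists_generatesFreePart_prime hB.1 hB.2.2.2.2.1 hq (Or.inr hq8)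
    refine (levelTwo_iff_genusPeriod_R2_delta hB.1 hB.2.1 hB.2.2.2.1 hB.2.2.2.2.1 hl hq hl8 hq8 rfl hr D hPr hC hBl h hgen α hα hδ).mpr
      (Or.inr ⟨?_, ?_⟩)
    · intro hX; exact (hV'.mp hX).1 hδ
    · intro h2; exact (hZ'.mp h2).1 hδ
  · by_cases hSq : RedeiTwo l q
    · have hTq : ¬ FourthPower l q := fun hTq => hcell ⟨hδ, hSq, hTq⟩
      exact (levelTwo_iff_genusPeriod_R2 hB.1 hB.2.1 hB.2.2.2.1 hB.2.2.2.2.1 hl hq hl8 hq8 rfl hr D hPr hC hBl h hgen hδ).mpr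
        (Or.inl ⟨hV'.mpr ⟨hδ, hSq, hTq⟩, hZ'.mpr ⟨hδ, hSq⟩, hZ4 hδ hSq hTq⟩)
    · exact (levelTwo_iff_genusPeriod_R2 hB.1 hB.2.1 hB.2.2.2.1 hB.2.2.2.2.1 hl hq hl8 hq8 rfl hr D hPr hC hBl h hgen hδ).mpr
        (Or.inr ⟨fun hX => hSq (hV'.mp hX).2.1, fun h2 => hSq (hZ'.mp h2).2⟩)

end Summit.BirchSwinnertonDyer.PrintCf2.LevelTwo.RedeiLaws

end
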